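import Mathlib
import Summits.Ventures.FusionMHD.Models.FluxSurfacePolarRay
import HarnessLib

/-!
# Polar-ray chart: the field hypotheses of Ampère's law / force balance FROM `C²` REGULARITY — radial, tangential and second ray
# fields of a flux that is `C²` on an open set, the polar divergence identity `∂_s(sD/R) + ∂_θ(D_t/R) = s·Δ*ψ/R` (chain rule +
# trace invariance, no symmetry of second derivatives needed), and the dictionary `Δ*ψ = ψ_RR − ψ_R/R + ψ_ZZ` in Fréchet form

LADDER-GRIDFUSION (F2 item R2 / F1 on the Cerfon–Freidberg rung), cell `gridfusion`, seat `gridfusion-model-7` (g6), 2026-08-27.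
Companion of `Models/FluxSurfacePolarRayAmpere.lean` and `Models/FluxSurfacePolarRayLevelForceBalance.lean`: those take the radial
field `D`, a tangential field `k = D_t/R`, its `θ`-derivative and the DIVERGENCE PRIMITIVE `∂_s(sD/R) = C·s·R − ∂_θk` as hypotheses;
this file CONSTRUCTS them for any flux `Ψ : ℝ × ℝ → ℝ` that is `C²` on an open set `Ω` containing the rays, from `fderiv`:
`radField = dΨ(ray)(e_r)`, `tanField = dΨ(ray)(e_θ)/R`, `radField₁ = d²Ψ(ray)(e_r, e_r)`,
`tanFieldθ = (s·d²Ψ(ray)(e_θ, e_θ) − radField)/R + dΨ(ray)(e_θ)·s sin θ/R²` (`e_r = (cos θ, sin θ)`, `e_θ = (−sin θ, cos θ)`,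
`R = R_c + s cos θ`), and PROVES: the `s`-derivative of `radField` is `radField₁`; the `θ`-derivative of `tanField` is `tanFieldθ`;
joint continuity of all four on sets whose rays stay in `Ω` with `R ≠ 0`; `2π`-periodicity; the identifications with
`radialDeriv`/`tangentialDeriv` of `fderiv Ψ`; and — given the Grad–Shafranov equation in Fréchet form
`d²Ψ(e₁,e₁) + d²Ψ(e₂,e₂) − dΨ(e₁)/R = C·R²` at the ray points — the divergence primitive
`HasDerivAt (s ↦ s·radField/R) (C·s·R − tanFieldθ) s` (trace invariance `d²Ψ(e_r,e_r) + d²Ψ(e_θ,e_θ) = d²Ψ(e₁,e₁) + d²Ψ(e₂,e₂)`).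
Finally `gsOperator_eq_fderiv`: for `ψ : ℝ → ℝ → ℝ` with `(R,Z) ↦ ψ R Z` `C²` near `(R, Z)`, `R ≠ 0`, the tree's nested-`deriv`
`gsOperator ψ R Z` equals `d²Ψ(e₁,e₁) − dΨ(e₁)/R + d²Ψ(e₂,e₂)` — so `Δ*ψ = C·R²` in the tree's sense supplies the Fréchet form.
All [folklore] calculus; MODELLED: nothing; no value claimed.  Consumers: instance files (CF ITER-like: `contDiffOn_cfSolution`,
`gsOperator_of_isInstance`) discharge `LevelLoop.ggjData_isForceBalanced` with these fields.
-/

noncomputable section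

open Real Set Filter Topology
open Literature.MathematicalPhysics.MHD.GradShafranov

namespace Summit.Ventures.FusionMHD.Models

namespace PolarRay

/-! ## §1 The fields of a `C²` flux along rays -/

/-- Radial field `D(θ, s) = dΨ(ray θ s)(cos θ, sin θ)` (`= ∂_sΨ(ray)`). [folklore] -/
def radField (Ψ : ℝ × ℝ → ℝ) (Rc Zc θ s : ℝ) : ℝ := fderiv ℝ Ψ (rayPoint Rc Zc θ s) (cos θ, sin θ)

/-- Second radial field `D₁(θ, s) = d²Ψ(ray θ s)(e_r)(e_r)` (`= ∂_s D`). [folklore] -/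
def radField₁ (Ψ : ℝ × ℝ → ℝ) (Rc Zc θ s : ℝ) : ℝ :=
  fderiv ℝ (fderiv ℝ Ψ) (rayPoint Rc Zc θ s) (cos θ, sin θ) (cos θ, sin θ)

/-- Tangential-over-radius field `k(θ, s) = dΨ(ray θ s)(−sin θ, cos θ)/(R_c + s cos θ)` (`= D_t/R`). [folklore] -/
def tanField (Ψ : ℝ × ℝ → ℝ) (Rc Zc θ s : ℝ) : ℝ :=
  fderiv ℝ Ψ (rayPoint Rc Zc θ s) (-sin θ, cos θ) / (Rc + s * cos θ)

/-- Its `θ`-derivative `∂_θk = (s·d²Ψ(ray)(e_θ)(e_θ) − D)/R + dΨ(ray)(e_θ)·s sin θ/R²`. [folklore] -/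
def tanFieldθ (Ψ : ℝ × ℝ → ℝ) (Rc Zc θ s : ℝ) : ℝ :=
  (s * fderiv ℝ (fderiv ℝ Ψ) (rayPoint Rc Zc θ s) (-sin θ, cos θ) (-sin θ, cos θ) - radField Ψ Rc Zc θ s) / (Rc + s * cos θ)
    + fderiv ℝ Ψ (rayPoint Rc Zc θ s) (-sin θ, cos θ) * (s * sin θ) / (Rc + s * cos θ) ^ 2

section calculus

variable {Ψ : ℝ × ℝ → ℝ} {Ω : Set (ℝ × ℝ)} {Rc Zc : ℝ}

/-- On an open set where `Ψ` is `C²`: `Ψ` is Fréchet-differentiable with derivative `fderiv`. [folklore] -/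
theorem hasFDerivAt_of_contDiffOn (hΩ : IsOpen Ω) (hC2 : ContDiffOn ℝ 2 Ψ Ω) {p : ℝ × ℝ} (hp : p ∈ Ω) :
    HasFDerivAt Ψ (fderiv ℝ Ψ p) p :=
  ((hC2.contDiffAt (hΩ.mem_nhds hp)).differentiableAt (by norm_num)).hasFDerivAt

/-- … and `fderiv Ψ` is Fréchet-differentiable with derivative `fderiv (fderiv Ψ)`. [folklore] -/
theorem hasFDerivAt_fderiv_of_contDiffOn (hΩ : IsOpen Ω) (hC2 : ContDiffOn ℝ 2 Ψ Ω) {p : ℝ × ℝ} (hp : p ∈ Ω) :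
    HasFDerivAt (fderiv ℝ Ψ) (fderiv ℝ (fderiv ℝ Ψ) p) p :=
  (((hC2.contDiffAt (hΩ.mem_nhds hp)).fderiv_right (m := 1) (by norm_num)).differentiableAt (by norm_num)).hasFDerivAt

/-- `θ ↦ ray θ s` has derivative `(−s sin θ, s cos θ)`. [folklore] -/
theorem hasDerivAt_rayPoint_theta (Rc Zc θ s : ℝ) :
    HasDerivAt (fun θ' => rayPoint Rc Zc θ' s) (s * -sin θ, s * cos θ) θ := by
  unfold rayPoint
  exact (((hasDerivAt_cos θ).const_mul s).const_add Rc).prodMk (((hasDerivAt_sin θ).const_mul s).const_add Zc)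

/-- `s ↦ ray θ s` has derivative `(cos θ, sin θ)`. [folklore] -/
theorem hasDerivAt_rayPoint_s (Rc Zc θ s : ℝ) :
    HasDerivAt (fun s' => rayPoint Rc Zc θ s') (cos θ, sin θ) s := by
  unfold rayPoint
  have h1 : HasDerivAt (fun s' => Rc + s' * cos θ) (cos θ) s := by
    simpa using ((hasDerivAt_id s).mul_const (cos θ)).const_add Rc
  have h2 : HasDerivAt (fun s' => Zc + s' * sin θ) (sin θ) s := by
    simpa using ((hasDerivAt_id s).mul_const (sin θ)).const_add Zc
  exact h1.prodMk h2

/-- **`∂_s D = D₁`.** [folklore] -/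
theorem hasDerivAt_radField_s (hΩ : IsOpen Ω) (hC2 : ContDiffOn ℝ 2 Ψ Ω) {θ s : ℝ} (hp : rayPoint Rc Zc θ s ∈ Ω) :
    HasDerivAt (fun s' => radField Ψ Rc Zc θ s') (radField₁ Ψ Rc Zc θ s) s := by
  unfold radField radField₁
  have h1 : HasDerivAt (fun s' => fderiv ℝ Ψ (rayPoint Rc Zc θ s'))
      (fderiv ℝ (fderiv ℝ Ψ) (rayPoint Rc Zc θ s) (cos θ, sin θ)) s :=
    (hasFDerivAt_fderiv_of_contDiffOn hΩ hC2 hp).comp_hasDerivAt s (hasDerivAt_rayPoint_s Rc Zc θ s)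
  have h2 := h1.clm_apply (hasDerivAt_const s ((cos θ, sin θ) : ℝ × ℝ))
  exact h2.congr_deriv (by rw [map_zero, add_zero])

/-- The numerator `θ ↦ dΨ(ray θ s)(e_θ(θ))` has derivative `s·d²Ψ(ray)(e_θ)(e_θ) − D`. [folklore] -/
theorem hasDerivAt_tanNumerator_theta (hΩ : IsOpen Ω) (hC2 : ContDiffOn ℝ 2 Ψ Ω) {θ s : ℝ} (hp : rayPoint Rc Zc θ s ∈ Ω) :
    HasDerivAt (fun θ' => fderiv ℝ Ψ (rayPoint Rc Zc θ' s) (-sin θ', cos θ'))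
      (s * fderiv ℝ (fderiv ℝ Ψ) (rayPoint Rc Zc θ s) (-sin θ, cos θ) (-sin θ, cos θ) - radField Ψ Rc Zc θ s) θ := by
  have het : HasDerivAt (fun θ' => ((-sin θ', cos θ') : ℝ × ℝ)) (-cos θ, -sin θ) θ :=
    (hasDerivAt_sin θ).neg.prodMk (hasDerivAt_cos θ)
  have h1 : HasDerivAt (fun θ' => fderiv ℝ Ψ (rayPoint Rc Zc θ' s))
      (fderiv ℝ (fderiv ℝ Ψ) (rayPoint Rc Zc θ s) (s * -sin θ, s * cos θ)) θ :=
    (hasFDerivAt_fderiv_of_contDiffOn hΩ hC2 hp).comp_hasDerivAt θ (hasDerivAt_rayPoint_theta Rc Zc θ s)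
  have h2 := h1.clm_apply het
  refine h2.congr_deriv ?_
  have e1 : ((s * -sin θ, s * cos θ) : ℝ × ℝ) = s • ((-sin θ, cos θ) : ℝ × ℝ) := by ext <;> simp
  have e2 : ((-cos θ, -sin θ) : ℝ × ℝ) = -((cos θ, sin θ) : ℝ × ℝ) := by ext <;> simp
  unfold radField
  rw [e1, e2, map_smul, map_neg, smul_apply, smul_eq_mul]
  ring

/-- **`∂_θ k = tanFieldθ`** (`R ≠ 0`). [folklore] -/
theorem hasDerivAt_tanField_theta (hΩ : IsOpen Ω) (hC2 : ContDiffOn ℝ 2 Ψ Ω) {θ s : ℝ} (hp : rayPoint Rc Zc θ s ∈ Ω)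
    (hR : Rc + s * cos θ ≠ 0) :
    HasDerivAt (fun θ' => tanField Ψ Rc Zc θ' s) (tanFieldθ Ψ Rc Zc θ s) θ := by
  have hnum := hasDerivAt_tanNumerator_theta (Rc := Rc) (Zc := Zc) hΩ hC2 hp
  have hden : HasDerivAt (fun θ' => Rc + s * cos θ') (s * -sin θ) θ := ((hasDerivAt_cos θ).const_mul s).const_add Rc
  have h := hnum.div hden hR
  unfold tanField tanFieldθ
  refine h.congr_deriv ?_
  field_simp
  ring

/-- Trace invariance of a bilinear map on `ℝ²` under the rotation to the polar frame:
`H(e_r)(e_r) + H(e_θ)(e_θ) = H(e₁)(e₁) + H(e₂)(e₂)` (no symmetry needed). [folklore] -/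
theorem trace_polarFrame (H : ℝ × ℝ →L[ℝ] ℝ × ℝ →L[ℝ] ℝ) (θ : ℝ) :
    H (cos θ, sin θ) (cos θ, sin θ) + H (-sin θ, cos θ) (-sin θ, cos θ)
      = H (1, 0) (1, 0) + H (0, 1) (0, 1) := by
  have er : ((cos θ, sin θ) : ℝ × ℝ) = cos θ • ((1 : ℝ), (0 : ℝ)) + sin θ • ((0 : ℝ), (1 : ℝ)) := by ext <;> simp
  have et : ((-sin θ, cos θ) : ℝ × ℝ) = (-sin θ) • ((1 : ℝ), (0 : ℝ)) + cos θ • ((0 : ℝ), (1 : ℝ)) := by ext <;> simp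
  rw [er, et]
  simp only [map_add, map_smul, add_apply, smul_apply, smul_eq_mul]
  have h := sin_sq_add_cos_sq θ
  linear_combination (H (1, 0) (1, 0) + H (0, 1) (0, 1)) * h

/-- The Fréchet derivative in the polar frame: `dΨ(e_r)·cos θ − dΨ(e_θ)·sin θ = dΨ(e₁)`. [folklore] -/
theorem fderiv_e1_of_polarFrame (Lp : ℝ × ℝ →L[ℝ] ℝ) (θ : ℝ) :
    Lp (cos θ, sin θ) * cos θ - Lp (-sin θ, cos θ) * sin θ = Lp (1, 0) := by
  have er : ((cos θ, sin θ) : ℝ × ℝ) = cos θ • ((1 : ℝ), (0 : ℝ)) + sin θ • ((0 : ℝ), (1 : ℝ)) := by ext <;> simp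
  have et : ((-sin θ, cos θ) : ℝ × ℝ) = (-sin θ) • ((1 : ℝ), (0 : ℝ)) + cos θ • ((0 : ℝ), (1 : ℝ)) := by ext <;> simp
  rw [er, et]
  simp only [map_add, map_smul, smul_eq_mul]
  have h := sin_sq_add_cos_sq θ
  linear_combination (Lp (1, 0)) * h

/-- The algebra of the divergence identity: with `R ≠ 0`, the trace identity, the frame identity and the Grad–Shafranov
equation in Fréchet form, the quotient-rule derivative of `s·D/R` equals `C·s·R − ∂_θk`. [folklore] -/
theorem divergence_algebra {R s c sn C Her Het H11 H22 Ler Let L1 : ℝ} (hR : R ≠ 0)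
    (htr : Her + Het = H11 + H22) (he1 : Ler * c - Let * sn = L1) (hGS : H11 + H22 - L1 / R = C * R ^ 2) :
    ((1 * Ler + s * Her) * R - s * Ler * c) / R ^ 2 = C * s * R - ((s * Het - Ler) / R + Let * (s * sn) / R ^ 2) := by
  have k0 : L1 / R = H11 + H22 - C * R ^ 2 := by linarith
  have k1 : L1 = (H11 + H22 - C * R ^ 2) * R := (div_eq_iff hR).mp k0
  have eR : C * s * R - ((s * Het - Ler) / R + Let * (s * sn) / R ^ 2)
      = (C * s * R ^ 3 - (s * Het - Ler) * R - Let * (s * sn)) / R ^ 2 := by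
    field_simp
    ring
  rw [eR, div_left_inj' (pow_ne_zero 2 hR)]
  linear_combination s * R * htr - s * he1 - s * k1

/-- **THE DIVERGENCE PRIMITIVE FROM THE GRAD–SHAFRANOV EQUATION.**  If at the ray point `p = ray θ s ∈ Ω` (`R = p.1 = R_c + s cos θ ≠ 0`)
the flux satisfies `d²Ψ(e₁,e₁) + d²Ψ(e₂,e₂) − dΨ(e₁)/R = C·R²` (Fréchet form of `Δ*Ψ = C·R²`, see `gsOperator_eq_fderiv`), then
`HasDerivAt (s ↦ s·D(θ,s)/R(θ,s)) (C·s·R − ∂_θk(θ,s)) s` — the polar form of `div(∇Ψ/R) = Δ*Ψ/R²·R`. [folklore] -/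
theorem hasDerivAt_divergencePrimitive (hΩ : IsOpen Ω) (hC2 : ContDiffOn ℝ 2 Ψ Ω) {θ s C : ℝ} (hp : rayPoint Rc Zc θ s ∈ Ω)
    (hR : Rc + s * cos θ ≠ 0)
    (hGS : fderiv ℝ (fderiv ℝ Ψ) (rayPoint Rc Zc θ s) (1, 0) (1, 0) + fderiv ℝ (fderiv ℝ Ψ) (rayPoint Rc Zc θ s) (0, 1) (0, 1)
      - fderiv ℝ Ψ (rayPoint Rc Zc θ s) (1, 0) / (Rc + s * cos θ) = C * (Rc + s * cos θ) ^ 2) :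
    HasDerivAt (fun s' => s' * radField Ψ Rc Zc θ s' / (Rc + s' * cos θ))
      (C * s * (Rc + s * cos θ) - tanFieldθ Ψ Rc Zc θ s) s := by
  have hD := hasDerivAt_radField_s (Rc := Rc) (Zc := Zc) hΩ hC2 hp
  have hnum : HasDerivAt (fun s' => s' * radField Ψ Rc Zc θ s') (1 * radField Ψ Rc Zc θ s + s * radField₁ Ψ Rc Zc θ s) s :=
    (hasDerivAt_id s).mul hD
  have hden : HasDerivAt (fun s' => Rc + s' * cos θ) (cos θ) s := by
    simpa using ((hasDerivAt_id s).mul_const (cos θ)).const_add Rc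
  have h := hnum.div hden hR
  refine h.congr_deriv ?_
  unfold tanFieldθ radField₁ radField
  exact divergence_algebra hR (trace_polarFrame _ θ) (fderiv_e1_of_polarFrame _ θ) hGS

/-- `D` IS the radial derivative of `fderiv Ψ` at the ray point: `D = radialDeriv (dΨ e₁) (dΨ e₂) θ`. [folklore] -/
theorem radField_eq_radialDeriv (Ψ : ℝ × ℝ → ℝ) (Rc Zc θ s : ℝ) :
    radField Ψ Rc Zc θ s
      = radialDeriv (fderiv ℝ Ψ (rayPoint Rc Zc θ s) (1, 0)) (fderiv ℝ Ψ (rayPoint Rc Zc θ s) (0, 1)) θ := by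
  unfold radField radialDeriv
  have er : ((cos θ, sin θ) : ℝ × ℝ) = cos θ • ((1 : ℝ), (0 : ℝ)) + sin θ • ((0 : ℝ), (1 : ℝ)) := by ext <;> simp
  rw [er, map_add, map_smul, map_smul, smul_eq_mul, smul_eq_mul]
  ring

/-- `k·R` IS the tangential derivative: `k·(R_c + s cos θ) = tangentialDeriv (dΨ e₁) (dΨ e₂) θ` (`R ≠ 0`). [folklore] -/
theorem tanField_mul_eq_tangentialDeriv (Ψ : ℝ × ℝ → ℝ) (Rc Zc θ : ℝ) {s : ℝ} (hR : Rc + s * cos θ ≠ 0) :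
    tanField Ψ Rc Zc θ s * (Rc + s * cos θ)
      = tangentialDeriv (fderiv ℝ Ψ (rayPoint Rc Zc θ s) (1, 0)) (fderiv ℝ Ψ (rayPoint Rc Zc θ s) (0, 1)) θ := by
  unfold tanField tangentialDeriv
  rw [div_mul_cancel₀ _ hR]
  have et : ((-sin θ, cos θ) : ℝ × ℝ) = (-sin θ) • ((1 : ℝ), (0 : ℝ)) + cos θ • ((0 : ℝ), (1 : ℝ)) := by ext <;> simp
  rw [et, map_add, map_smul, map_smul, smul_eq_mul, smul_eq_mul]
  ring

/-- `D` is also the `s`-derivative of the ray profile `s ↦ Ψ(ray θ s)`. [folklore] -/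
theorem hasDerivAt_rayProfile_radField (hΩ : IsOpen Ω) (hC2 : ContDiffOn ℝ 2 Ψ Ω) {θ s : ℝ} (hp : rayPoint Rc Zc θ s ∈ Ω) :
    HasDerivAt (fun s' => Ψ (rayPoint Rc Zc θ s')) (radField Ψ Rc Zc θ s) s :=
  (hasFDerivAt_of_contDiffOn hΩ hC2 hp).comp_hasDerivAt s (hasDerivAt_rayPoint_s Rc Zc θ s)

/-- Periodicity: `tanField (θ + 2π) s = tanField θ s`. [folklore] -/
theorem tanField_periodic (Ψ : ℝ × ℝ → ℝ) (Rc Zc θ s : ℝ) : tanField Ψ Rc Zc (θ + 2 * π) s = tanField Ψ Rc Zc θ s := by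
  unfold tanField rayPoint
  rw [cos_add_two_pi, sin_add_two_pi]

/-! ## §2 Joint continuity on sets whose rays stay in `Ω` with `R ≠ 0` -/

/-- The ray map is continuous. [folklore] -/
theorem continuous_rayPoint_uncurry (Rc Zc : ℝ) : Continuous (fun p : ℝ × ℝ => rayPoint Rc Zc p.1 p.2) := by
  unfold rayPoint; fun_prop

variable {K : Set (ℝ × ℝ)}

/-- Joint continuity of `radField` on `K` (rays in `Ω`). [folklore] -/
theorem continuousOn_radField (hΩ : IsOpen Ω) (hC2 : ContDiffOn ℝ 2 Ψ Ω) (hK : ∀ p ∈ K, rayPoint Rc Zc p.1 p.2 ∈ Ω) :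
    ContinuousOn (fun p : ℝ × ℝ => radField Ψ Rc Zc p.1 p.2) K := by
  unfold radField
  exact ((hC2.continuousOn_fderiv_of_isOpen hΩ (by norm_num)).comp (continuous_rayPoint_uncurry Rc Zc).continuousOn hK).clm_apply
    (by fun_prop)

/-- Joint continuity of `radField₁` on `K`. [folklore] -/
theorem continuousOn_radField₁ (hΩ : IsOpen Ω) (hC2 : ContDiffOn ℝ 2 Ψ Ω) (hK : ∀ p ∈ K, rayPoint Rc Zc p.1 p.2 ∈ Ω) :
    ContinuousOn (fun p : ℝ × ℝ => radField₁ Ψ Rc Zc p.1 p.2) K := by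
  unfold radField₁
  have hH : ContinuousOn (fderiv ℝ (fderiv ℝ Ψ)) Ω :=
    (hC2.fderiv_of_isOpen hΩ (m := 1) (by norm_num)).continuousOn_fderiv_of_isOpen hΩ le_rfl
  exact (((hH.comp (continuous_rayPoint_uncurry Rc Zc).continuousOn hK).clm_apply (by fun_prop)).clm_apply (by fun_prop))

/-- Joint continuity of `tanField` on `K` (`R ≠ 0` there). [folklore] -/
theorem continuousOn_tanField (hΩ : IsOpen Ω) (hC2 : ContDiffOn ℝ 2 Ψ Ω) (hK : ∀ p ∈ K, rayPoint Rc Zc p.1 p.2 ∈ Ω)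
    (hR : ∀ p ∈ K, Rc + p.2 * cos p.1 ≠ 0) :
    ContinuousOn (fun p : ℝ × ℝ => tanField Ψ Rc Zc p.1 p.2) K := by
  unfold tanField
  refine ContinuousOn.div ?_ (by fun_prop) hR
  exact ((hC2.continuousOn_fderiv_of_isOpen hΩ (by norm_num)).comp (continuous_rayPoint_uncurry Rc Zc).continuousOn hK).clm_apply
    (by fun_prop)

/-- Joint continuity of `tanFieldθ` on `K` (`R ≠ 0` there). [folklore] -/
theorem continuousOn_tanFieldθ (hΩ : IsOpen Ω) (hC2 : ContDiffOn ℝ 2 Ψ Ω) (hK : ∀ p ∈ K, rayPoint Rc Zc p.1 p.2 ∈ Ω)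
    (hR : ∀ p ∈ K, Rc + p.2 * cos p.1 ≠ 0) :
    ContinuousOn (fun p : ℝ × ℝ => tanFieldθ Ψ Rc Zc p.1 p.2) K := by
  have hL : ContinuousOn (fun p : ℝ × ℝ => fderiv ℝ Ψ (rayPoint Rc Zc p.1 p.2)) K :=
    (hC2.continuousOn_fderiv_of_isOpen hΩ (by norm_num)).comp (continuous_rayPoint_uncurry Rc Zc).continuousOn hK
  have hH : ContinuousOn (fun p : ℝ × ℝ => fderiv ℝ (fderiv ℝ Ψ) (rayPoint Rc Zc p.1 p.2)) K :=
    ((hC2.fderiv_of_isOpen hΩ (m := 1) (by norm_num)).continuousOn_fderiv_of_isOpen hΩ le_rfl).comp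
      (continuous_rayPoint_uncurry Rc Zc).continuousOn hK
  have hD := continuousOn_radField (Rc := Rc) (Zc := Zc) hΩ hC2 hK
  have het : ContinuousOn (fun p : ℝ × ℝ => ((-sin p.1, cos p.1) : ℝ × ℝ)) K := by fun_prop
  have h1 : ContinuousOn (fun p : ℝ × ℝ => fderiv ℝ (fderiv ℝ Ψ) (rayPoint Rc Zc p.1 p.2) (-sin p.1, cos p.1) (-sin p.1, cos p.1)) K :=
    (hH.clm_apply het).clm_apply het
  have h2 : ContinuousOn (fun p : ℝ × ℝ => fderiv ℝ Ψ (rayPoint Rc Zc p.1 p.2) (-sin p.1, cos p.1)) K := hL.clm_apply het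
  have hRc : ContinuousOn (fun p : ℝ × ℝ => Rc + p.2 * cos p.1) K := by fun_prop
  have hA : ContinuousOn (fun p : ℝ × ℝ => (p.2 * fderiv ℝ (fderiv ℝ Ψ) (rayPoint Rc Zc p.1 p.2) (-sin p.1, cos p.1) (-sin p.1, cos p.1)
      - radField Ψ Rc Zc p.1 p.2) / (Rc + p.2 * cos p.1)) K := ((continuousOn_snd.mul h1).sub hD).div hRc hR
  have hB : ContinuousOn (fun p : ℝ × ℝ => fderiv ℝ Ψ (rayPoint Rc Zc p.1 p.2) (-sin p.1, cos p.1) * (p.2 * sin p.1)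
      / (Rc + p.2 * cos p.1) ^ 2) K :=
    (h2.mul (by fun_prop)).div (hRc.pow 2) fun p hp => pow_ne_zero 2 (hR p hp)
  exact hA.add hB

end calculus

/-! ## §3 The dictionary with the tree's `gsOperator` -/

/-- **`Δ*ψ` IN FRÉCHET FORM.**  For a flux `Ψ : ℝ × ℝ → ℝ` that is `C²` on an open `Ω ∋ (R, Z)` with `R ≠ 0`, the tree's
nested-`deriv` operator of the curried function `ψ R Z := Ψ (R, Z)` satisfies
`gsOperator ψ R Z = d²Ψ(e₁,e₁) − dΨ(e₁)/R + d²Ψ(e₂,e₂)` at `(R, Z)` (Freidberg (6.7); expanded form PCF §3.1).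
[cite: Freidberg2014, §6.2.2 eq. (6.7)] -/
theorem gsOperator_eq_fderiv {Ψ : ℝ × ℝ → ℝ} {Ω : Set (ℝ × ℝ)} (hΩ : IsOpen Ω) (hC2 : ContDiffOn ℝ 2 Ψ Ω) {R Z : ℝ}
    (hp : (R, Z) ∈ Ω) (hR : R ≠ 0) :
    gsOperator (fun r z => Ψ (r, z)) R Z
      = fderiv ℝ (fderiv ℝ Ψ) (R, Z) (1, 0) (1, 0) - fderiv ℝ Ψ (R, Z) (1, 0) / R
        + fderiv ℝ (fderiv ℝ Ψ) (R, Z) (0, 1) (0, 1) := by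
  -- first partials at points of Ω are the Fréchet components
  have hdR : ∀ q ∈ Ω, dR (fun r z => Ψ (r, z)) q.1 q.2 = fderiv ℝ Ψ q (1, 0) := fun q hq =>
    (dR_dZ_of_hasFDerivAt (ψ := fun r z => Ψ (r, z)) (R := q.1) (Z := q.2) (hasFDerivAt_of_contDiffOn hΩ hC2 hq)).1
  have hdZ : ∀ q ∈ Ω, dZ (fun r z => Ψ (r, z)) q.1 q.2 = fderiv ℝ Ψ q (0, 1) := fun q hq =>
    (dR_dZ_of_hasFDerivAt (ψ := fun r z => Ψ (r, z)) (R := q.1) (Z := q.2) (hasFDerivAt_of_contDiffOn hΩ hC2 hq)).2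
  have hH := hasFDerivAt_fderiv_of_contDiffOn hΩ hC2 hp
  have hlR : HasDerivAt (fun r : ℝ => ((r, Z) : ℝ × ℝ)) ((1 : ℝ), (0 : ℝ)) R := (hasDerivAt_id R).prodMk (hasDerivAt_const R Z)
  have hlZ : HasDerivAt (fun z : ℝ => ((R, z) : ℝ × ℝ)) ((0 : ℝ), (1 : ℝ)) Z := (hasDerivAt_const Z R).prodMk (hasDerivAt_id Z)
  -- second R-derivative
  have hΩR : ∀ᶠ r in 𝓝 R, ((r, Z) : ℝ × ℝ) ∈ Ω :=
    (Continuous.prodMk_left Z).continuousAt.preimage_mem_nhds (hΩ.mem_nhds hp)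
  have hdRfun : (fun r => dR (fun r z => Ψ (r, z)) r Z) =ᶠ[𝓝 R] fun r => fderiv ℝ Ψ (r, Z) (1, 0) := by
    filter_upwards [hΩR] with r hr; exact hdR (r, Z) hr
  have hderivR : HasDerivAt (fun r => fderiv ℝ Ψ (r, Z) (1, 0))
      (fderiv ℝ (fderiv ℝ Ψ) (R, Z) (1, 0) (1, 0)) R := by
    have h1 : HasDerivAt (fun r => fderiv ℝ Ψ (r, Z)) (fderiv ℝ (fderiv ℝ Ψ) (R, Z) ((1 : ℝ), (0 : ℝ))) R :=
      hH.comp_hasDerivAt R hlR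
    have h2 := h1.clm_apply (hasDerivAt_const R (((1 : ℝ), (0 : ℝ)) : ℝ × ℝ))
    exact h2.congr_deriv (by rw [map_zero, add_zero])
  have hderivR' : HasDerivAt (fun r => dR (fun r z => Ψ (r, z)) r Z) (fderiv ℝ (fderiv ℝ Ψ) (R, Z) (1, 0) (1, 0)) R :=
    hderivR.congr_of_eventuallyEq hdRfun
  have hdRR : dRR (fun r z => Ψ (r, z)) R Z = fderiv ℝ (fderiv ℝ Ψ) (R, Z) (1, 0) (1, 0) := by
    unfold dRR
    rw [iteratedDeriv_succ, iteratedDeriv_one]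
    exact hderivR'.deriv
  -- second Z-derivative
  have hΩZ : ∀ᶠ z in 𝓝 Z, ((R, z) : ℝ × ℝ) ∈ Ω :=
    (Continuous.prodMk_right R).continuousAt.preimage_mem_nhds (hΩ.mem_nhds hp)
  have hdZfun : (fun z => dZ (fun r z => Ψ (r, z)) R z) =ᶠ[𝓝 Z] fun z => fderiv ℝ Ψ (R, z) (0, 1) := by
    filter_upwards [hΩZ] with z hz; exact hdZ (R, z) hz
  have hderivZ : HasDerivAt (fun z => fderiv ℝ Ψ (R, z) (0, 1))
      (fderiv ℝ (fderiv ℝ Ψ) (R, Z) (0, 1) (0, 1)) Z := by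
    have h1 : HasDerivAt (fun z => fderiv ℝ Ψ (R, z)) (fderiv ℝ (fderiv ℝ Ψ) (R, Z) ((0 : ℝ), (1 : ℝ))) Z :=
      hH.comp_hasDerivAt Z hlZ
    have h2 := h1.clm_apply (hasDerivAt_const Z (((0 : ℝ), (1 : ℝ)) : ℝ × ℝ))
    exact h2.congr_deriv (by rw [map_zero, add_zero])
  have hderivZ' : HasDerivAt (fun z => dZ (fun r z => Ψ (r, z)) R z) (fderiv ℝ (fderiv ℝ Ψ) (R, Z) (0, 1) (0, 1)) Z :=
    hderivZ.congr_of_eventuallyEq hdZfun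
  have hdZZ : dZZ (fun r z => Ψ (r, z)) R Z = fderiv ℝ (fderiv ℝ Ψ) (R, Z) (0, 1) (0, 1) := by
    unfold dZZ
    rw [iteratedDeriv_succ, iteratedDeriv_one]
    have e : deriv (fun z => Ψ (R, z)) = fun z => dZ (fun r z => Ψ (r, z)) R z := rfl
    rw [e]
    exact hderivZ'.deriv
  rw [gsOperator_eq_expanded hR hderivR'.differentiableAt, hdRR, hdZZ, hdR (R, Z) hp]
  ring

end PolarRay

end Summit.Ventures.FusionMHD.Models

end
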